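import Mathlib
import Summits.RiemannHypothesis.RiemannHypothesis.Theorems.WeilFarFloorCoshTest
import Literature.NumberTheory.LFunctions.WeilMarkovQuadratic
import Literature.NumberTheory.LFunctions.WeilWindowSuzukiProofs
import Literature.NumberTheory.LFunctions.WeilArchDensityTail
import HarnessLib

/-!
# The archimedean energy of the cosh profile is at most `2I₀·‖C_b‖²`

Helper file (`--supports stmt-RiemannHypothesis-0098`, lead-track anchor: Weil-positivity window ladder, format-C far bound),
pure proofs, RH-free.  Seat rh-explicit-weil-1 gen12 (memo `run/shared/lean/pub/rh-explicit/rh-explicit-weil-1/FORMAT-K3.md` §13).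

For the cosh profile `C_b = cosh(·/2)·1_{[−b,b]}` of the window (`‖C_b‖² = b + sinh b`, `WeilFarFloorCoshTest`) the increments are
explicit (`coshProfile_increment_eq`): for `0 ≤ t ≤ 2b`

  `∫ (C_b(x+t) − C_b(x))² dx = 2(1 − e^{−t/2})(b + sinh b) + t·cosh(t/2) − 2(b − e^{−b})·sinh(t/2)`,

and `= 2(b + sinh b)` for `t > 2b`.  Against the archimedean density `ρ_∞(t) = e^{t/2}/(2 sinh t)` the first term integrates to the
killing integral `I₀ = ∫₀^∞ (e^{t/2} − 1)/(2 sinh t) dt` of the RH anatomy (`ρ_∞(t)(1 − e^{−t/2}) = (e^{t/2} − 1)/(2 sinh t)`), while the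
rest has NONPOSITIVE integral once `b ≥ 4` (`ρ_∞ t cosh(t/2) ≤ (t+1)/2`, `ρ_∞ sinh(t/2) ≥ (1 − e^{−t})/2`, tail `≤ 2(b + sinh b)e^{−2b}/(1 − e^{−4b})`):
**`∫_{(t₀,∞)} ρ_∞(t)·∫(C_b(x+t) − C_b(x))² dx dt ≤ 2I₀·(b + sinh b)`** for `b ≥ 4`, `0 < t₀ ≤ 1` (`coshProfile_archEnergy_le`), with the
integrability of the integrand on `(t₀, ∞)`.  This is the large-scale budget `A = 2I₀` of the cosh-split ceiling (`WeilFarFloorCoshSplitRH`):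
with it the `2I₀` of the killing constant cancels and the RH ceiling of the prime-shift form reads `e^b + 2b − log 4π − γ + o(1)`.
Standard axioms only.
-/

set_option linter.dupNamespace false
set_option autoImplicit false

noncomputable section

open MeasureTheory Set Filter
open scoped Real Topology

namespace Summit.RiemannHypothesis.RiemannHypothesis.Theorems.WeilFormatC

namespace FloorCoshSplit

open Literature.NumberTheory.LFunctions FloorCosh

variable {b t : ℝ}

/-! ## §1 The increments of the cosh profile -/

/-- `∫ C_b(x+t) C_b(x) dx = sinh(b − t/2) + (2b − t)cosh(t/2)/2` for `0 ≤ t ≤ 2b`. -/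
theorem integral_coshProfile_shiftAdd_mul (ht0 : 0 ≤ t) (ht : t ≤ 2 * b) :
    ∫ x, (Icc (-b) b).indicator (fun y ↦ Real.cosh (y / 2)) (x + t) * (Icc (-b) b).indicator (fun y ↦ Real.cosh (y / 2)) x
      = Real.sinh (b - t / 2) + (2 * b - t) * Real.cosh (t / 2) / 2 := by
  set C := (Icc (-b) b).indicator (fun y ↦ Real.cosh (y / 2)) with hC
  rw [← integral_coshTest_shift_mul (a := b) ht0 ht, ← integral_add_right_eq_self (fun x ↦ C (x - t) * C x) t]
  refine integral_congr_ae (Eventually.of_forall fun x ↦ ?_)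
  show C (x + t) * C x = C (x + t - t) * C (x + t)
  rw [add_sub_cancel_right, mul_comm]

/-- `∫ C_b(x+t) C_b(x) dx = 0` for `t > 2b` (disjoint supports). -/
theorem integral_coshProfile_shiftAdd_mul_eq_zero (ht : 2 * b < t) :
    ∫ x, (Icc (-b) b).indicator (fun y ↦ Real.cosh (y / 2)) (x + t) * (Icc (-b) b).indicator (fun y ↦ Real.cosh (y / 2)) x
      = 0 := by
  refine integral_eq_zero_of_ae (Eventually.of_forall fun x ↦ ?_)
  by_cases hx : x ∈ Icc (-b) b
  · have hxt : x + t ∉ Icc (-b) b := fun h ↦ by linarith [h.2, hx.1]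
    simp only [indicator_of_notMem hxt, zero_mul, Pi.zero_apply]
  · simp only [indicator_of_notMem hx, mul_zero, Pi.zero_apply]

/-- `∫ (C_b(x+t) − C_b(x))² = 2(b + sinh b) − 2∫ C_b(x+t)C_b(x)` (`b ≥ 0`). -/
theorem integral_sq_coshProfile_shiftAdd_sub (hb : 0 ≤ b) (t : ℝ) :
    ∫ x, ((Icc (-b) b).indicator (fun y ↦ Real.cosh (y / 2)) (x + t) - (Icc (-b) b).indicator (fun y ↦ Real.cosh (y / 2)) x) ^ 2
      = 2 * (b + Real.sinh b) - 2 * ∫ x, (Icc (-b) b).indicator (fun y ↦ Real.cosh (y / 2)) (x + t)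
          * (Icc (-b) b).indicator (fun y ↦ Real.cosh (y / 2)) x := by
  set C := (Icc (-b) b).indicator (fun y ↦ Real.cosh (y / 2)) with hC
  obtain ⟨hCm, hCb, hCs⟩ := coshTest_admissible b
  have hi : ∀ s r : ℝ, Integrable (fun x ↦ C (x + s) * C (x + r)) := fun s r ↦
    (integrable_shift_mul_shift hCm hCb hCs (-s) (-r)).congr (Eventually.of_forall fun x ↦ by simp only [sub_neg_eq_add, hC])
  have i1 := hi t t
  have i2 := hi t 0
  have i3 := hi 0 0
  simp only [add_zero] at i2 i3
  have hsq : ∀ y, C y * C y = C y ^ 2 := fun y ↦ by ring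
  have hP : ∫ x, C x ^ 2 = b + Real.sinh b := by rw [hC, integral_coshTest_sq hb]
  have e1 : ∫ x, C (x + t) * C (x + t) = b + Real.sinh b := by
    rw [integral_add_right_eq_self (fun y ↦ C y * C y) t]; simp_rw [hsq]; exact hP
  have e3 : ∫ x, C x * C x = b + Real.sinh b := by simp_rw [hsq]; exact hP
  have e : ∀ x, (C (x + t) - C x) ^ 2 = C (x + t) * C (x + t) - 2 * (C (x + t) * C x) + C x * C x := fun x ↦ by ring
  simp_rw [e]
  rw [integral_add (f := fun x ↦ C (x + t) * C (x + t) - 2 * (C (x + t) * C x)) (g := fun x ↦ C x * C x)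
      (i1.sub (i2.const_mul 2)) i3,
    integral_sub (f := fun x ↦ C (x + t) * C (x + t)) (g := fun x ↦ 2 * (C (x + t) * C x)) i1 (i2.const_mul 2),
    integral_const_mul, e1, e3]
  ring

/-- **The increments of the cosh profile**: for `0 ≤ t ≤ 2b` (`b ≥ 0`),
`∫ (C_b(x+t) − C_b(x))² = 2(1 − e^{−t/2})(b + sinh b) + (t cosh(t/2) − 2(b − e^{−b}) sinh(t/2))`. -/
theorem coshProfile_increment_eq (hb : 0 ≤ b) (ht0 : 0 ≤ t) (ht : t ≤ 2 * b) :
    ∫ x, ((Icc (-b) b).indicator (fun y ↦ Real.cosh (y / 2)) (x + t) - (Icc (-b) b).indicator (fun y ↦ Real.cosh (y / 2)) x) ^ 2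
      = 2 * (1 - Real.exp (-(t / 2))) * (b + Real.sinh b)
        + (t * Real.cosh (t / 2) - 2 * (b - Real.exp (-b)) * Real.sinh (t / 2)) := by
  rw [integral_sq_coshProfile_shiftAdd_sub hb, integral_coshProfile_shiftAdd_mul ht0 ht, Real.sinh_sub,
    ← Real.cosh_sub_sinh (t / 2), ← Real.cosh_sub_sinh b]
  ring

/-- For `t > 2b ≥ 0` the supports separate: `∫ (C_b(x+t) − C_b(x))² = 2(b + sinh b)`. -/
theorem coshProfile_increment_eq_of_lt (hb : 0 ≤ b) (ht : 2 * b < t) :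
    ∫ x, ((Icc (-b) b).indicator (fun y ↦ Real.cosh (y / 2)) (x + t) - (Icc (-b) b).indicator (fun y ↦ Real.cosh (y / 2)) x) ^ 2
      = 2 * (b + Real.sinh b) := by
  rw [integral_sq_coshProfile_shiftAdd_sub hb, integral_coshProfile_shiftAdd_mul_eq_zero ht]; ring

/-! ## §2 The archimedean density against the three pieces -/

/-- `ρ_∞(t)·(1 − e^{−t/2}) = (e^{t/2} − 1)/(2 sinh t)`: the killing density of the RH anatomy. -/
theorem weilArchDensity_mul_one_sub_exp (t : ℝ) :
    weilArchDensity t * (1 - Real.exp (-(t / 2))) = (Real.exp (t / 2) - 1) / (2 * Real.sinh t) := by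
  unfold weilArchDensity
  have h : Real.exp (t / 2) * Real.exp (-(t / 2)) = 1 := by rw [← Real.exp_add]; simp
  rw [div_mul_eq_mul_div, mul_sub, mul_one, h]

/-- `ρ_∞(t)·t·cosh(t/2) ≤ (t + 1)/2` for `t > 0` (i.e. `t e^t + t + 1 ≤ e^{2t}`). -/
theorem weilArchDensity_mul_mul_cosh_le (ht : 0 < t) :
    weilArchDensity t * (t * Real.cosh (t / 2)) ≤ (t + 1) / 2 := by
  unfold weilArchDensity
  have hs : 0 < Real.sinh t := Real.sinh_pos_iff.2 ht
  rw [div_mul_eq_mul_div, div_le_div_iff₀ (by positivity) (by norm_num)]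
  -- `2 e^{t/2} t cosh(t/2) = t(e^t + 1)` and `2 sinh t = e^t − e^{−t}`
  set E := Real.exp (t / 2) with hE
  have hE0 : 0 < E := Real.exp_pos _
  have hEt : Real.exp t = E ^ 2 := by rw [hE, ← Real.exp_nat_mul]; ring_nf
  have hEt' : Real.exp (-t) = (E ^ 2)⁻¹ := by rw [Real.exp_neg, hEt]
  have hcosh : Real.cosh (t / 2) = (E + E⁻¹) / 2 := by rw [Real.cosh_eq, hE, Real.exp_neg]
  have hsinh : Real.sinh t = (E ^ 2 - (E ^ 2)⁻¹) / 2 := by rw [Real.sinh_eq, hEt, hEt']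
  have h1 : 1 + t ≤ E ^ 2 := by rw [← hEt]; linarith [Real.add_one_le_exp t]
  rw [hcosh, hsinh]
  have hE2 : 0 < E ^ 2 := by positivity
  field_simp
  nlinarith [mul_le_mul_of_nonneg_left h1 hE2.le, mul_le_mul_of_nonneg_right h1 (by linarith : (0 : ℝ) ≤ 1 + t), hE2]

/-- `ρ_∞(t)·sinh(t/2) ≥ (1 − e^{−t})/2` for `t > 0` (it equals `1/(2(1 + e^{−t}))`). -/
theorem half_sub_exp_le_weilArchDensity_mul_sinh (ht : 0 < t) :
    (1 - Real.exp (-t)) / 2 ≤ weilArchDensity t * Real.sinh (t / 2) := by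
  unfold weilArchDensity
  have hs : 0 < Real.sinh t := Real.sinh_pos_iff.2 ht
  set E := Real.exp (t / 2) with hE
  have hE0 : 0 < E := Real.exp_pos _
  have hE1 : 1 < E := by rw [hE]; exact Real.one_lt_exp_iff.2 (by linarith)
  have hEt : Real.exp t = E ^ 2 := by rw [hE, ← Real.exp_nat_mul]; ring_nf
  have hEt' : Real.exp (-t) = (E ^ 2)⁻¹ := by rw [Real.exp_neg, hEt]
  have hsinh2 : Real.sinh (t / 2) = (E - E⁻¹) / 2 := by rw [Real.sinh_eq, hE, Real.exp_neg]
  have hsinh : Real.sinh t = (E ^ 2 - (E ^ 2)⁻¹) / 2 := by rw [Real.sinh_eq, hEt, hEt']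
  rw [hEt', hsinh2, hsinh]
  have hE2 : 1 < E ^ 2 := by nlinarith
  rw [div_mul_eq_mul_div, le_div_iff₀ (by
    have : 0 < E ^ 2 - (E ^ 2)⁻¹ := by
      have : (E ^ 2)⁻¹ < 1 := inv_lt_one_of_one_lt₀ hE2
      linarith
    positivity)]
  field_simp
  nlinarith [hE0, hE1, hE2]

/-- `ρ_∞(t) = (e^{t/2} − 1)/(2 sinh t) + 1/(2 sinh t)` and, for `t ≥ 2b > 0`, `1/(2 sinh t) ≤ e^{−t}/(1 − e^{−4b})`:
`ρ_∞(t) ≤ (e^{t/2} − 1)/(2 sinh t) + e^{−t}/(1 − e^{−4b})`. -/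
theorem weilArchDensity_le_killing_add (hb : 0 < b) (ht : 2 * b ≤ t) :
    weilArchDensity t ≤ (Real.exp (t / 2) - 1) / (2 * Real.sinh t) + Real.exp (-t) / (1 - Real.exp (-(4 * b))) := by
  have ht0 : 0 < t := by linarith
  have hs : 0 < Real.sinh t := Real.sinh_pos_iff.2 ht0
  have hsplit : weilArchDensity t = (Real.exp (t / 2) - 1) / (2 * Real.sinh t) + 1 / (2 * Real.sinh t) := by
    unfold weilArchDensity; field_simp; ring
  rw [hsplit, add_le_add_iff_left]
  have hq : 0 < 1 - Real.exp (-(4 * b)) := by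
    have : Real.exp (-(4 * b)) < 1 := Real.exp_lt_one_iff.2 (by linarith)
    linarith
  rw [div_le_div_iff₀ (by positivity) hq, one_mul]
  -- `2 sinh t = e^t − e^{−t} = e^t (1 − e^{−2t}) ≥ e^t (1 − e^{−4b})`
  have h2t : Real.exp (-(4 * b)) ≥ Real.exp (-(2 * t)) := Real.exp_le_exp.2 (by linarith)
  have hid : Real.exp (-t) * (2 * Real.sinh t) = 1 - Real.exp (-(2 * t)) := by
    rw [Real.sinh_eq, show -(2 * t) = -t + -t by ring, Real.exp_add]
    have : Real.exp (-t) * Real.exp t = 1 := by rw [← Real.exp_add]; simp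
    nlinarith [this]
  linarith

/-! ## §3 The energy bound -/

set_option maxHeartbeats 400000 in
/-- **The archimedean energy of the cosh profile beyond any cut is at most `2I₀·(b + sinh b)`** (`b ≥ 4`, `0 < t₀ ≤ 1`):
`∫_{(t₀,∞)} ρ_∞(t)·∫(C_b(x+t) − C_b(x))² dx dt ≤ 2(∫_{(0,∞)} (e^{t/2} − 1)/(2 sinh t) dt)·(b + sinh b)`, and the integrand is integrable on
`(t₀, ∞)`.  Proof: on `(t₀, 2b]` the increment identity and `ρ_∞ t cosh(t/2) ≤ (t+1)/2`, `ρ_∞ sinh(t/2) ≥ (1 − e^{−t})/2` bound the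
excess over `2(b + sinh b)·(e^{t/2} − 1)/(2 sinh t)` by `(t+1)/2 − (b − e^{−b})(1 − e^{−t})`, whose integral is
`≤ b² + b − (b − e^{−b})(2b − 2)`; on `(2b, ∞)` the excess is `≤ 2(b + sinh b)e^{−t}/(1 − e^{−4b})`, integral `≤ 2(b + sinh b)e^{−2b}/(1 − e^{−4b})`;
the total excess is `≤ −b² + 3b + 2 ≤ 0`. -/
theorem coshProfile_archEnergy_le (hb : 4 ≤ b) {t₀ : ℝ} (ht₀ : 0 < t₀) (ht₁ : t₀ ≤ 1) :
    IntegrableOn (fun t ↦ weilArchDensity t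
        * ∫ x, ((Icc (-b) b).indicator (fun y ↦ Real.cosh (y / 2)) (x + t)
            - (Icc (-b) b).indicator (fun y ↦ Real.cosh (y / 2)) x) ^ 2) (Ioi t₀) ∧
      ∫ t in Ioi t₀, weilArchDensity t
          * ∫ x, ((Icc (-b) b).indicator (fun y ↦ Real.cosh (y / 2)) (x + t)
              - (Icc (-b) b).indicator (fun y ↦ Real.cosh (y / 2)) x) ^ 2
        ≤ 2 * (∫ t in Ioi (0 : ℝ), (Real.exp (t / 2) - 1) / (2 * Real.sinh t)) * (b + Real.sinh b) := by
  set C := (Icc (-b) b).indicator (fun y ↦ Real.cosh (y / 2)) with hC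
  set P := b + Real.sinh b with hP
  set β := b - Real.exp (-b) with hβ
  set κ : ℝ → ℝ := fun t ↦ (Real.exp (t / 2) - 1) / (2 * Real.sinh t) with hκ
  have hb0 : 0 < b := by linarith
  have hsb : 0 < Real.sinh b := Real.sinh_pos_iff.2 hb0
  have hP0 : 0 < P := by rw [hP]; linarith
  have ht2b : t₀ < 2 * b := by linarith
  -- the two pieces of `(t₀, ∞)`
  have hU : Ioi t₀ = Ioc t₀ (2 * b) ∪ Ioi (2 * b) := (Ioc_union_Ioi_eq_Ioi ht2b.le).symm
  -- piece 1: on `(t₀, 2b]` the integrand is `ρ · g₁` with `g₁` continuous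
  set g₁ : ℝ → ℝ := fun t ↦ 2 * (1 - Real.exp (-(t / 2))) * P
      + (t * Real.cosh (t / 2) - 2 * β * Real.sinh (t / 2)) with hg₁
  have hD1 : ∀ t ∈ Ioc t₀ (2 * b), ∫ x, (C (x + t) - C x) ^ 2 = g₁ t := fun t ht ↦ by
    rw [hg₁, hC, coshProfile_increment_eq hb0.le (ht₀.le.trans ht.1.le) ht.2]
  have hρcont : ContinuousOn weilArchDensity (Icc t₀ (2 * b)) := by
    unfold weilArchDensity
    refine ContinuousOn.div (by fun_prop) (by fun_prop) fun t ht ↦ ?_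
    have : 0 < Real.sinh t := Real.sinh_pos_iff.2 (ht₀.trans_le ht.1)
    positivity
  have hg₁cont : Continuous g₁ := by rw [hg₁]; fun_prop
  have hI1 : IntegrableOn (fun t ↦ weilArchDensity t * ∫ x, (C (x + t) - C x) ^ 2) (Ioc t₀ (2 * b)) := by
    have h : IntegrableOn (fun t ↦ weilArchDensity t * g₁ t) (Ioc t₀ (2 * b)) :=
      ((hρcont.mul hg₁cont.continuousOn).integrableOn_Icc).mono_set Ioc_subset_Icc_self
    exact h.congr_fun (fun t ht ↦ by rw [hD1 t ht]) measurableSet_Ioc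
  -- piece 2: on `(2b, ∞)` the integrand is `2P ρ`
  have hD2 : ∀ t ∈ Ioi (2 * b), ∫ x, (C (x + t) - C x) ^ 2 = 2 * P := fun t ht ↦ by
    rw [hP, hC, coshProfile_increment_eq_of_lt hb0.le ht]
  have hρ2 := integrableOn_weilArchDensity_Ioi (by linarith : 0 < 2 * b)
  have hI2 : IntegrableOn (fun t ↦ weilArchDensity t * ∫ x, (C (x + t) - C x) ^ 2) (Ioi (2 * b)) := by
    have h : IntegrableOn (fun t ↦ weilArchDensity t * (2 * P)) (Ioi (2 * b)) := hρ2.mul_const (2 * P)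
    exact h.congr_fun (fun t ht ↦ by rw [hD2 t ht]) measurableSet_Ioi
  have hInt : IntegrableOn (fun t ↦ weilArchDensity t * ∫ x, (C (x + t) - C x) ^ 2) (Ioi t₀) := by
    rw [hU]; exact hI1.union hI2
  refine ⟨hInt, ?_⟩
  -- the killing density: integrable, nonnegative
  have hκi : IntegrableOn κ (Ioi 0) := integrableOn_weilKillingDensity
  have hκ0 : ∀ t, 0 < t → 0 ≤ κ t := fun t ht ↦ weilKillingDensity_nonneg ht
  -- piece 1 bound
  set m₁ : ℝ → ℝ := fun t ↦ (t + 1) / 2 - β * (1 - Real.exp (-t)) with hm₁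
  have hβ0 : 0 ≤ β := by
    rw [hβ]; have : Real.exp (-b) ≤ 1 := Real.exp_le_one_iff.2 (by linarith); linarith
  have hpt1 : ∀ t ∈ Ioc t₀ (2 * b), weilArchDensity t * ∫ x, (C (x + t) - C x) ^ 2 ≤ 2 * P * κ t + m₁ t := by
    intro t ht
    have ht0 : 0 < t := ht₀.trans ht.1
    rw [hD1 t ht, hg₁, hm₁]
    have h1 := weilArchDensity_mul_mul_cosh_le ht0
    have h2 := half_sub_exp_le_weilArchDensity_mul_sinh ht0
    have h3 := weilArchDensity_mul_one_sub_exp t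
    have hρ := (weilArchDensity_pos ht0).le
    have h2' := mul_le_mul_of_nonneg_left h2 hβ0
    have e : weilArchDensity t * (2 * (1 - Real.exp (-(t / 2))) * P + (t * Real.cosh (t / 2) - 2 * β * Real.sinh (t / 2)))
        = 2 * P * (weilArchDensity t * (1 - Real.exp (-(t / 2)))) + weilArchDensity t * (t * Real.cosh (t / 2))
          - 2 * (β * (weilArchDensity t * Real.sinh (t / 2))) := by ring
    rw [e, h3]
    linarith
  have hm₁i : IntegrableOn m₁ (Ioc t₀ (2 * b)) := (by rw [hm₁]; fun_prop : Continuous m₁).integrableOn_Icc.mono_set Ioc_subset_Icc_self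
  have hκ1 : IntegrableOn κ (Ioc t₀ (2 * b)) := hκi.mono_set fun t ht ↦ ht₀.trans ht.1
  have hm₁v : ∫ t in Ioc t₀ (2 * b), m₁ t ≤ b ^ 2 + b - β * (2 * b - 2) := by
    have hderiv : ∀ t ∈ uIcc t₀ (2 * b), HasDerivAt (fun t ↦ (t + 1) ^ 2 / 4 - β * (t + Real.exp (-t))) (m₁ t) t := by
      intro t _
      have h1 := (((hasDerivAt_id t).add_const (1 : ℝ)).pow 2).div_const 4
      have h2 := ((hasDerivAt_id t).add ((Real.hasDerivAt_exp (-t)).comp t (hasDerivAt_neg t))).const_mul β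
      have h := h1.sub h2
      simp only [id, Function.comp_def] at h
      refine h.congr_deriv ?_
      simp only [hm₁]
      ring
    rw [← intervalIntegral.integral_of_le ht2b.le,
      intervalIntegral.integral_eq_sub_of_hasDerivAt hderiv ((by rw [hm₁]; fun_prop : Continuous m₁).intervalIntegrable _ _)]
    have e1 : Real.exp (-(2 * b)) ≥ 0 := (Real.exp_pos _).le
    have e2 : Real.exp (-t₀) ≤ 1 := Real.exp_le_one_iff.2 (by linarith)
    nlinarith [mul_nonneg hβ0 e1, mul_nonneg hβ0 (by linarith : (0:ℝ) ≤ 1 - Real.exp (-t₀)), mul_nonneg hβ0 ht₀.le,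
      sq_nonneg t₀, ht₀]
  have hpiece1 : ∫ t in Ioc t₀ (2 * b), weilArchDensity t * ∫ x, (C (x + t) - C x) ^ 2
      ≤ 2 * P * (∫ t in Ioc t₀ (2 * b), κ t) + (b ^ 2 + b - β * (2 * b - 2)) := by
    calc ∫ t in Ioc t₀ (2 * b), weilArchDensity t * ∫ x, (C (x + t) - C x) ^ 2
        ≤ ∫ t in Ioc t₀ (2 * b), (2 * P * κ t + m₁ t) :=
          setIntegral_mono_on hI1 ((hκ1.const_mul _).add hm₁i) measurableSet_Ioc hpt1
      _ = 2 * P * (∫ t in Ioc t₀ (2 * b), κ t) + ∫ t in Ioc t₀ (2 * b), m₁ t := by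
          rw [integral_add (hκ1.const_mul _) hm₁i, integral_const_mul]
      _ ≤ _ := by linarith [hm₁v]
  -- piece 2 bound
  have hq : 0 < 1 - Real.exp (-(4 * b)) := by
    have : Real.exp (-(4 * b)) < 1 := Real.exp_lt_one_iff.2 (by linarith); linarith
  have hpt2 : ∀ t ∈ Ioi (2 * b), weilArchDensity t * ∫ x, (C (x + t) - C x) ^ 2
      ≤ 2 * P * κ t + 2 * P / (1 - Real.exp (-(4 * b))) * Real.exp (-t) := by
    intro t ht
    rw [hD2 t ht]
    have h := weilArchDensity_le_killing_add hb0 (le_of_lt ht)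
    have := mul_le_mul_of_nonneg_left h (by positivity : (0 : ℝ) ≤ 2 * P)
    have e : 2 * P * ((Real.exp (t / 2) - 1) / (2 * Real.sinh t) + Real.exp (-t) / (1 - Real.exp (-(4 * b))))
        = 2 * P * κ t + 2 * P / (1 - Real.exp (-(4 * b))) * Real.exp (-t) := by rw [hκ]; ring
    linarith
  have hκ2 : IntegrableOn κ (Ioi (2 * b)) := hκi.mono_set (Ioi_subset_Ioi (by linarith))
  have hexpi := integrableOn_exp_neg_Ioi (2 * b)
  have hpiece2 : ∫ t in Ioi (2 * b), weilArchDensity t * ∫ x, (C (x + t) - C x) ^ 2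
      ≤ 2 * P * (∫ t in Ioi (2 * b), κ t) + 2 * P / (1 - Real.exp (-(4 * b))) * Real.exp (-(2 * b)) := by
    calc ∫ t in Ioi (2 * b), weilArchDensity t * ∫ x, (C (x + t) - C x) ^ 2
        ≤ ∫ t in Ioi (2 * b), (2 * P * κ t + 2 * P / (1 - Real.exp (-(4 * b))) * Real.exp (-t)) :=
          setIntegral_mono_on hI2 ((hκ2.const_mul _).add (hexpi.const_mul _)) measurableSet_Ioi hpt2
      _ = 2 * P * (∫ t in Ioi (2 * b), κ t) + 2 * P / (1 - Real.exp (-(4 * b))) * Real.exp (-(2 * b)) := by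
          rw [integral_add (hκ2.const_mul _) (hexpi.const_mul _), integral_const_mul, integral_const_mul,
            integral_exp_neg_Ioi]
  -- the killing integral over `(t₀, ∞)` is at most `I₀`
  have hκsum : (∫ t in Ioc t₀ (2 * b), κ t) + ∫ t in Ioi (2 * b), κ t ≤ ∫ t in Ioi 0, κ t := by
    rw [← setIntegral_union (Ioc_disjoint_Ioi le_rfl) measurableSet_Ioi hκ1 hκ2, ← hU]
    exact setIntegral_mono_set hκi ((ae_restrict_iff' measurableSet_Ioi).2 (Eventually.of_forall fun t ht ↦ hκ0 t ht))
      (Ioi_subset_Ioi ht₀.le).eventuallyLE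
  -- the excess is nonpositive for `b ≥ 4`
  have hexcess : (b ^ 2 + b - β * (2 * b - 2)) + 2 * P / (1 - Real.exp (-(4 * b))) * Real.exp (-(2 * b)) ≤ 0 := by
    -- `e^{−b} ≤ 2/b²`, `e^{−4b} ≤ 1/2`, `sinh b ≤ e^b/2`
    have heb : Real.exp (-b) * (b ^ 2 / 2) ≤ 1 := by
      have h := Real.quadratic_le_exp_of_nonneg hb0.le
      have h' : Real.exp (-b) * Real.exp b = 1 := by rw [← Real.exp_add]; simp
      nlinarith [Real.exp_pos (-b)]
    have hb2 : 16 ≤ b ^ 2 := by nlinarith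
    have heb' : Real.exp (-b) ≤ 1 / 8 := by
      nlinarith [Real.exp_pos (-b), mul_le_mul_of_nonneg_left hb2 (Real.exp_pos (-b)).le]
    have he2b : Real.exp (-(2 * b)) = Real.exp (-b) ^ 2 := by rw [← Real.exp_nat_mul]; ring_nf
    have he4b : Real.exp (-(4 * b)) ≤ 1 / 2 := by
      have : Real.exp (-(4 * b)) ≤ Real.exp (-b) := Real.exp_le_exp.2 (by linarith)
      linarith
    have hsinh : Real.sinh b * Real.exp (-b) ≤ 1 / 2 := by
      rw [Real.sinh_eq]
      have h' : Real.exp (-b) * Real.exp b = 1 := by rw [← Real.exp_add]; simp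
      nlinarith [Real.exp_pos (-b)]
    have hPe : P * Real.exp (-(2 * b)) ≤ b * Real.exp (-b) ^ 2 + Real.exp (-b) / 2 := by
      rw [he2b, hP]; nlinarith [Real.exp_pos (-b)]
    have hfrac : 2 * P / (1 - Real.exp (-(4 * b))) * Real.exp (-(2 * b)) ≤ 4 * (P * Real.exp (-(2 * b))) := by
      rw [div_mul_eq_mul_div, div_le_iff₀ hq]
      nlinarith [mul_nonneg hP0.le (Real.exp_pos (-(2 * b))).le]
    have hbe : b * Real.exp (-b) ≤ 1 / 2 := by nlinarith [Real.exp_pos (-b)]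
    rw [hβ]
    nlinarith [Real.exp_pos (-b), hbe, heb', hPe, hfrac]
  -- assemble
  rw [hU, setIntegral_union (Ioc_disjoint_Ioi le_rfl) measurableSet_Ioi hI1 hI2]
  have hκP := mul_le_mul_of_nonneg_left hκsum (by positivity : (0 : ℝ) ≤ 2 * P)
  rw [hκ] at hκP
  linarith [hpiece1, hpiece2, hexcess, hκP]

end FloorCoshSplit

end Summit.RiemannHypothesis.RiemannHypothesis.Theorems.WeilFormatC
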